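import Summits.HodgeConjecture.CorCM.SimpleCMFourfoldCurvePowersHodgeOfMarkman
import Summits.HodgeConjecture.CorCM.OcticCMFieldPrimeToThreeAllTypes
import Summits.HodgeConjecture.CorCM.CyclotomicRankCensusOctic
import HarnessLib

/-!
# Weil-type family coverage — THE CYCLOTOMIC CM FOURFOLDS OF WEIL TYPE ARE NOT SIMPLE: a CM type of an octic CM
# field with `k`-signature `(2,2)` over an imaginary quadratic subfield is DEGENERATE; hence no SIMPLE abelian
# fourfold of Weil type has a GALOIS CM field, and in particular none has multiplication by `ℚ(ζ₁₅)`, `ℚ(ζ₁₆)`,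
# `ℚ(ζ₂₀)` or `ℚ(ζ₂₄)`

research route conditional on HC_CM; not a corollary; Q11.4-sentence-2 already refuted in dim ≥ 3.

Ring 2, WEIL-TYPE FAMILY-COVERAGE CENSUS (`HOME/WEIL-FAMILY-COVERAGE.md` `## b01`, block b01.46 «the cyclotomic CM
FOURFOLDS of Weil type»; owner ring2-b01 = the `g = 4` owner), part 78 of the `Ring2WeilCoverage*` series, the
geometric companion of parts 75–77 (which decide the `ι`-compatible polarisation types of the `K`-balanced CM tori
`ℂ^Φ/Φ(ℤ[ζ_M])`, `M ∈ {15, 16, 20, 24}`).  WHICH fourfolds are these?  The census knew in words (b01.7 LEMMA /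
habitat T1.8: «`A₄, S₄`: simple `K`-Weil CM fibre; `V₄, C₄, D₄`: every balanced type imprimitive») and the COR-CM lane
has the kernel ingredients; this file assembles them into the census-facing statements:

* §1 **`not_isNondegenerate_of_card_filter_eq_two`** — for ANY CM field `K` of degree `8`, any imaginary quadratic
  `k` with `i : k → K`, `τ : k → ℂ`, and any CM type `Φ` of `K` with exactly two members over `τ` (`k`-signature
  `(2,2)`: the realisations of `Φ` are abelian fourfolds of WEIL TYPE for `k`), `Φ` is DEGENERATE (Kubota rank `< 5`)
  — the type induced from `(k; {τ})` has quadratic reflex and meets `Φ` in `2 = 8/4` places, so the reflex field of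
  `Φ` has degree `≤ 4·… < 8` [Dodson §3.1]; the normal-closure prologue of COR-CM's
  `OcticWeilFourfold.twoTransitive_of_isSimple` with `Literature…not_isNondegenerate_of_ncard_inter_eq_two`.
* §2 **`not_isSimple_of_card_filter_eq_two_of_isGalois` — NO SIMPLE ABELIAN FOURFOLD OF WEIL TYPE HAS A GALOIS CM
  FIELD**: if `K` is Galois over `ℚ`, every realisation `(B, ι, θ)` of such a `Φ` is NOT simple (a simple one would be
  primitive, Shimura §8.2 Prop. 26, hence nondegenerate by COR-CM's Dodson-§3.3.2 theorem
  `OcticPrimeToThreeAllTypes.isNondegenerate_of_isPrimitive_octic_of_embedding` — `3 ∤ 8 = |Gal(K/ℚ)|`);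
  **`card_filter_eq_one_or_eq_three_of_isSimple_of_isGalois`**: a SIMPLE CM fourfold with Galois CM field `K ⊃ k` has
  `k`-signature `(1,3)` or `(3,1)` for every imaginary quadratic `k ⊂ K` (signatures `(0,4)/(4,0)` are COR-CM's
  `SimpleCMFourfoldCurve.not_isSimple_of_card_filter_eq_zero/_four`).
* §3 the four octic CYCLOTOMIC fields (`φ(M) = 8`): **`not_isSimple_of_card_filter_eq_two_fifteen/_sixteen/_twenty/
  _twentyFour`** — a Weil-type abelian fourfold with multiplication by `ℤ[ζ_M]` (`M = 15, 16, 20, 24`; `K`-signature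
  `(2,2)` for an imaginary quadratic `k ⊂ ℚ(ζ_M)`) is NOT simple (§1 + COR-CM's certified Kubota-rank census
  `CyclotomicRank.isNondegenerate_iff_isSimple_M`: for these fields nondegenerate ⟺ primitive ⟺ simple).  So the CM
  points `ℂ^Φ/Φ(ℤ[ζ_M])` of parts 75–77 on the `g = 4` Weil components are NON-simple (isogenous to squares of CM
  surfaces or fourth powers of CM elliptic curves), and the `8` SIMPLE CM fourfolds of each of these fields (the
  primitive types; HC for all their powers unconditional, `CyclotomicRank.hodgeConjectureFor_pow_of_isSimple_M`)
  are of Weil type for NO imaginary quadratic subfield.  HC for the Weil-type ones and all their powers is COR-CM's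
  `OcticPrimeToThreeAllTypes.hodgeConjectureFor_pow_octic_of_embedding` (every abelian fourfold with an action of an
  octic CM field inside a Galois CM field of degree prime to `3`), unconditionally — cited, not restated.

HONEST FRAMING: statements about CM types (Kubota nondegeneracy) and simplicity of CM abelian fourfolds; assembled
from COR-CM / Literature tree theorems (Dodson 1984, Kubota 1965, Shimura §8.2 Prop. 26); nothing here is a statement
about Hodge classes of general members, `W_K` or HC; `HC_CM` is used nowhere.  No `def`, no named fact, no `sorry`.

References: [cite: Dodson1984, §3.1.1, §3.3.2]; [cite: Shimura1998, §8.2 Prop. 26]; [cite: Kubota1965, §2]; census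
b01.7 LEMMA, b01.46 (seat-derived).
-/

noncomputable section

open CategoryTheory CategoryTheory.Limits NumberField

namespace Summit.HodgeConjecture.Ring2WeilCoverage.CyclotomicWeilFourfoldsNonsimple

open Literature.AlgebraicGeometry Literature.AlgebraicGeometry.Motives Literature.AlgebraicGeometry.HodgeTheory
open Literature.AlgebraicGeometry.ComplexMultiplication (IsCMTypeRealisation isSimple_iff_isPrimitive)
open Literature.AlgebraicGeometry.Pohlmann1968 (IsNondegenerate)
open Literature.NumberTheory.ComplexMultiplication
open Summit.HodgeConjecture.CorCM.OcticWeilFourfold (countable_of_numberField')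
open Summit.HodgeConjecture.CorCM.SimpleCMFourfoldCurve (not_isSimple_of_card_filter_eq_zero
  not_isSimple_of_card_filter_eq_four)
open Summit.HodgeConjecture.CorCM.OcticCurveFourfold (card_filter_comp_eq_four)
open Summit.HodgeConjecture.CorCM.OcticPrimeToThreeAllTypes (isNondegenerate_of_isPrimitive_octic_of_embedding)
open Summit.HodgeConjecture.CorCM.CyclotomicRank

open scoped Classical

open IntermediateField

variable {K : Type} [Field K] [NumberField K] [IsCMField K] {k : Type} [Field k] [NumberField k] [IsCMField k]
  {Φ : CMType K} {B : AbelianVariety ℂ} {ιB : 𝓞 K →+* End B} {θB : K →+* Module.End ℂ (complexBetti B.X 1)}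

/-! ### §1 `k`-signature `(2,2)` on an octic CM field is a DEGENERATE type -/

/-- **A CM type of Weil type over an imaginary quadratic subfield of an OCTIC CM field is degenerate.**  `K` a CM field
of degree `8`, `k` imaginary quadratic with `i : k → K`, `τ : k → ℂ`, `Φ` a CM type of `K` with exactly two members
over `τ` (`k`-signature `(2,2)`).  Then `Φ` is NOT nondegenerate (Kubota rank `< 5`): in the Galois closure
`Kᶜ ⊂ ℂ` the type `Φ₀` induced from `(k; {τ})` has a reflex field of degree `2` and `|Φ ∩ Φ₀| = 2`, which bounds the
reflex degree of `Φ` below `8` (tree: `not_isNondegenerate_of_ncard_inter_eq_two`, Dodson §3.1; the prologue is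
COR-CM's `OcticWeilFourfold.twoTransitive_of_isSimple`).
research route conditional on HC_CM; not a corollary; Q11.4-sentence-2 already refuted in dim ≥ 3. [cite: Dodson1984, §3.1.1 Theorem] -/
theorem not_isNondegenerate_of_card_filter_eq_two (h8 : Module.finrank ℚ K = 8) (h2 : Module.finrank ℚ k = 2)
    (i : k →+* K) (τ : k →+* ℂ) (Φ : CMType K)
    (h22 : (Finset.univ.filter fun s : K →+* ℂ => s.comp i = τ ∧ s ∈ Φ.1).card = 2) :
    ¬ IsNondegenerate Φ := by
  -- an embedding `s` of `K` over `τ` (the filter is nonempty)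
  obtain ⟨s, hs⟩ : ∃ s, s ∈ Finset.univ.filter fun s : K →+* ℂ => s.comp i = τ ∧ s ∈ Φ.1 := by
    by_contra h
    push Not at h
    rw [Finset.eq_empty_of_forall_notMem h, Finset.card_empty] at h22
    exact absurd h22 (by decide)
  -- the Galois closure `L = Kᶜ ⊂ ℂ`, a Galois CM field
  let L : Type := ↥(normalClosure ℚ K ℂ)
  haveI : IsNormalClosure ℚ K L := Algebra.IsAlgebraic.isNormalClosure_normalClosure fun x => IsAlgClosed.splits _
  haveI : NumberField L := { to_charZero := inferInstance, to_finiteDimensional := inferInstance }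
  haveI : IsCMField L := Literature.NumberTheory.NumberFields.isCMField_normalClosure K
  haveI : IsGalois ℚ L := Literature.NumberTheory.NumberFields.isGalois_normalClosure_complex K
  haveI : Countable L := countable_of_numberField' L
  let ι : L →+* ℂ := algebraMap L ℂ
  let φ : K →ₐ[ℚ] ℂ := s.toRatAlgHom
  let j : K →ₐ[ℚ] L := φ.codRestrict (normalClosure ℚ K ℂ).toSubalgebra fun x => φ.fieldRange_le_normalClosure ⟨x, rfl⟩
  -- the block of `k`: the type induced from `(k; {τ})`, with quadratic reflex field
  let Φ₀ : CMType K := inducedCMType i (CMTypeCount.single h2 τ)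
  have hΦ₀ : ∀ u : K →+* ℂ, u ∈ Φ₀.1 ↔ u.comp i = τ := fun u => by
    change u.comp i ∈ (CMTypeCount.single h2 τ).1 ↔ _
    rw [CMTypeCount.single_val, Set.mem_singleton_iff]
  have h2q : Module.finrank ℚ (reflexField ℚ L (algValuedIn ι Φ₀.1)) = 2 :=
    finrank_reflexField_algValuedIn_inducedCMType_single h2 i j ι τ
  -- `Φ` has weight `2` over the block, hence is degenerate
  have hinter : (Φ.1 ∩ Φ₀.1).ncard = 2 := by
    have hset : Φ.1 ∩ Φ₀.1 = ↑(Finset.univ.filter fun s : K →+* ℂ => s.comp i = τ ∧ s ∈ Φ.1) := by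
      ext u
      rw [Finset.coe_filter]
      simp only [Set.mem_inter_iff, Finset.mem_univ, true_and, Set.mem_setOf_eq, hΦ₀ u]
      tauto
    rw [hset, Set.ncard_coe_finset, h22]
  exact not_isNondegenerate_of_ncard_inter_eq_two h8 j ι Φ₀ Φ h2q hinter

/-! ### §2 Galois octic CM fields: Weil type ⟹ not simple -/

/-- **NO SIMPLE ABELIAN FOURFOLD OF WEIL TYPE HAS A GALOIS CM FIELD.**  `K` a CM field of degree `8`, GALOIS over
`ℚ`; `k` imaginary quadratic, `i : k → K`, `τ : k → ℂ`; `Φ` a CM type of `K` with `k`-signature `(2,2)`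
(`#{s ∈ Φ | s ∘ i = τ} = 2`); `(B, ι, θ)` a realisation of `(K; Φ)` (a CM abelian fourfold of Weil type for `k`).
Then `B` is NOT simple: simple ⟹ `Φ` primitive (Shimura §8.2 Prop. 26) ⟹ nondegenerate (Dodson §3.3.2: a primitive
degenerate octic type forces `3 ∣ |Gal|`, but `|Gal(K/ℚ)| = 8`; COR-CM `isNondegenerate_of_isPrimitive_octic_of_embedding`
with `L = K`), contradicting §1.  (Dodson: the simple CM fourfolds of Weil type have NON-Galois CM fields, Galois
closure `ℤ₂ × A₄` or `ℤ₂ × S₄`.)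
research route conditional on HC_CM; not a corollary; Q11.4-sentence-2 already refuted in dim ≥ 3. [cite: Dodson1984, §3.3.2 Theorem] [cite: Shimura1998, §8.2 Prop. 26] -/
theorem not_isSimple_of_card_filter_eq_two_of_isGalois [IsGalois ℚ K] (h8 : Module.finrank ℚ K = 8)
    (h2 : Module.finrank ℚ k = 2) (i : k →+* K) (τ : k →+* ℂ) (hB : IsCMTypeRealisation Φ B ιB θB)
    (h22 : (Finset.univ.filter fun s : K →+* ℂ => s.comp i = τ ∧ s ∈ Φ.1).card = 2) : ¬ B.IsSimple := by
  intro hS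
  obtain ⟨φ₀⟩ := (inferInstance : Nonempty (K →+* ℂ))
  have hprim : IsPrimitive (ℂ ≃+* ℂ) Φ.1 φ₀ := (isSimple_iff_isPrimitive hB φ₀).1 hS
  have h3 : ¬ 3 ∣ Module.finrank ℚ K := by rw [h8]; decide
  exact not_isNondegenerate_of_card_filter_eq_two h8 h2 i τ Φ h22
    (isNondegenerate_of_isPrimitive_octic_of_embedding h8 (AlgHom.id ℚ K) h3 Φ φ₀ hprim)

/-- **A SIMPLE CM fourfold with a GALOIS CM field has `k`-signature `(1,3)` or `(3,1)` for every imaginary quadratic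
`k ⊂ K`**: `#{s ∈ Φ | s ∘ i = τ} ∈ {1, 3}` — `2` is excluded by `not_isSimple_of_card_filter_eq_two_of_isGalois`,
`0` and `4` (the type would be induced from `k`, `B ∼ E⁴`) by COR-CM's
`SimpleCMFourfoldCurve.not_isSimple_of_card_filter_eq_zero/_four`; the fibre has `4` elements.
research route conditional on HC_CM; not a corollary; Q11.4-sentence-2 already refuted in dim ≥ 3. [cite: Dodson1984, §3.3.2 Theorem] [cite: Shimura1998, §8.2 Prop. 26] -/
theorem card_filter_eq_one_or_eq_three_of_isSimple_of_isGalois [IsGalois ℚ K] (h8 : Module.finrank ℚ K = 8)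
    (h2 : Module.finrank ℚ k = 2) (i : k →+* K) (τ : k →+* ℂ) (hB : IsCMTypeRealisation Φ B ιB θB)
    (hS : B.IsSimple) :
    (Finset.univ.filter fun s : K →+* ℂ => s.comp i = τ ∧ s ∈ Φ.1).card = 1 ∨
      (Finset.univ.filter fun s : K →+* ℂ => s.comp i = τ ∧ s ∈ Φ.1).card = 3 := by
  have hle : (Finset.univ.filter fun s : K →+* ℂ => s.comp i = τ ∧ s ∈ Φ.1).card ≤ 4 := by
    rw [← card_filter_comp_eq_four i h8 h2 τ]
    exact Finset.card_le_card fun s hs => by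
      simp only [Finset.mem_filter, Finset.mem_univ, true_and] at hs ⊢
      exact hs.1
  have h0 := fun h => not_isSimple_of_card_filter_eq_zero h8 h2 i hB τ h hS
  have h2' := fun h => not_isSimple_of_card_filter_eq_two_of_isGalois h8 h2 i τ hB h hS
  have h4 := fun h => not_isSimple_of_card_filter_eq_four h8 h2 i hB τ h hS
  interval_cases (Finset.univ.filter fun s : K →+* ℂ => s.comp i = τ ∧ s ∈ Φ.1).card <;> simp_all

/-! ### §3 The four octic cyclotomic fields: Weil-type `ℤ[ζ_M]`-fourfolds are not simple -/

omit [IsCMField K] in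
/-- `[ℚ(ζ₁₅) : ℚ] = 8`. [folklore] -/
theorem finrank_fifteen [IsCyclotomicExtension {15} ℚ K] : Module.finrank ℚ K = 8 := by
  rw [IsCyclotomicExtension.finrank K (Polynomial.cyclotomic.irreducible_rat (by norm_num : 0 < 15))]; decide

omit [IsCMField K] in
/-- `[ℚ(ζ₁₆) : ℚ] = 8`. [folklore] -/
theorem finrank_sixteen [IsCyclotomicExtension {16} ℚ K] : Module.finrank ℚ K = 8 := by
  rw [IsCyclotomicExtension.finrank K (Polynomial.cyclotomic.irreducible_rat (by norm_num : 0 < 16))]; decide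

omit [IsCMField K] in
/-- `[ℚ(ζ₂₀) : ℚ] = 8`. [folklore] -/
theorem finrank_twenty [IsCyclotomicExtension {20} ℚ K] : Module.finrank ℚ K = 8 := by
  rw [IsCyclotomicExtension.finrank K (Polynomial.cyclotomic.irreducible_rat (by norm_num : 0 < 20))]; decide

omit [IsCMField K] in
/-- `[ℚ(ζ₂₄) : ℚ] = 8`. [folklore] -/
theorem finrank_twentyFour [IsCyclotomicExtension {24} ℚ K] : Module.finrank ℚ K = 8 := by
  rw [IsCyclotomicExtension.finrank K (Polynomial.cyclotomic.irreducible_rat (by norm_num : 0 < 24))]; decide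

/-- **A Weil-type abelian fourfold with multiplication by `ℤ[ζ₁₅]` is NOT simple**: for any `K` with
`IsCyclotomicExtension {15} ℚ K`, any imaginary quadratic `k` with `i : k → K` (`k = ℚ(√−15)` or `ℚ(√−3)`), `τ`, any CM
type `Φ` with `k`-signature `(2,2)` and any realisation `(B, ι, θ)` of `(K; Φ)`: `¬ B` simple (§1 + COR-CM's
`CyclotomicRank.isNondegenerate_iff_isSimple_fifteen`).  These are the CM points `ℂ^Φ/Φ(ℤ[ζ₁₅])` of parts 75/77's
NO rows `(15, ℚ(√−15))`, `(15, ℚ(√−3))`.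
research route conditional on HC_CM; not a corollary; Q11.4-sentence-2 already refuted in dim ≥ 3. [cite: Kubota1965, §2] [cite: Shimura1998, §8.2 Prop. 26] -/
theorem not_isSimple_of_card_filter_eq_two_fifteen [IsCyclotomicExtension {15} ℚ K] (h2 : Module.finrank ℚ k = 2)
    (i : k →+* K) (τ : k →+* ℂ) (hB : IsCMTypeRealisation Φ B ιB θB)
    (h22 : (Finset.univ.filter fun s : K →+* ℂ => s.comp i = τ ∧ s ∈ Φ.1).card = 2) : ¬ B.IsSimple :=
  fun hS => not_isNondegenerate_of_card_filter_eq_two finrank_fifteen h2 i τ Φ h22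
    ((isNondegenerate_iff_isSimple_fifteen hB).2 hS)

/-- **A Weil-type abelian fourfold with multiplication by `ℤ[ζ₁₆]` is NOT simple** (`k = ℚ(i)` or `ℚ(√−2)`; the CM
points of part 76's rows `(16, ℚ(i))`, `(16, ℚ(√−2))`).
research route conditional on HC_CM; not a corollary; Q11.4-sentence-2 already refuted in dim ≥ 3. [cite: Kubota1965, §2] [cite: Shimura1998, §8.2 Prop. 26] -/
theorem not_isSimple_of_card_filter_eq_two_sixteen [IsCyclotomicExtension {16} ℚ K] (h2 : Module.finrank ℚ k = 2)
    (i : k →+* K) (τ : k →+* ℂ) (hB : IsCMTypeRealisation Φ B ιB θB)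
    (h22 : (Finset.univ.filter fun s : K →+* ℂ => s.comp i = τ ∧ s ∈ Φ.1).card = 2) : ¬ B.IsSimple :=
  fun hS => not_isNondegenerate_of_card_filter_eq_two finrank_sixteen h2 i τ Φ h22
    ((isNondegenerate_iff_isSimple_sixteen hB).2 hS)

/-- **A Weil-type abelian fourfold with multiplication by `ℤ[ζ₂₀]` is NOT simple** (`k = ℚ(i)` or `ℚ(√−5)`; the CM
points of part 75's rows `(20, ℚ(i))`, `(20, ℚ(√−5))`).
research route conditional on HC_CM; not a corollary; Q11.4-sentence-2 already refuted in dim ≥ 3. [cite: Kubota1965, §2] [cite: Shimura1998, §8.2 Prop. 26] -/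
theorem not_isSimple_of_card_filter_eq_two_twenty [IsCyclotomicExtension {20} ℚ K] (h2 : Module.finrank ℚ k = 2)
    (i : k →+* K) (τ : k →+* ℂ) (hB : IsCMTypeRealisation Φ B ιB θB)
    (h22 : (Finset.univ.filter fun s : K →+* ℂ => s.comp i = τ ∧ s ∈ Φ.1).card = 2) : ¬ B.IsSimple :=
  fun hS => not_isNondegenerate_of_card_filter_eq_two finrank_twenty h2 i τ Φ h22
    ((isNondegenerate_iff_isSimple_twenty hB).2 hS)

/-- **A Weil-type abelian fourfold with multiplication by `ℤ[ζ₂₄]` is NOT simple** (`k ∈ {ℚ(i), ℚ(√−2), ℚ(√−3),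
ℚ(√−6)}`; the CM points of part 75's rows at `24`).
research route conditional on HC_CM; not a corollary; Q11.4-sentence-2 already refuted in dim ≥ 3. [cite: Kubota1965, §2] [cite: Shimura1998, §8.2 Prop. 26] -/
theorem not_isSimple_of_card_filter_eq_two_twentyFour [IsCyclotomicExtension {24} ℚ K]
    (h2 : Module.finrank ℚ k = 2) (i : k →+* K) (τ : k →+* ℂ) (hB : IsCMTypeRealisation Φ B ιB θB)
    (h22 : (Finset.univ.filter fun s : K →+* ℂ => s.comp i = τ ∧ s ∈ Φ.1).card = 2) : ¬ B.IsSimple :=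
  fun hS => not_isNondegenerate_of_card_filter_eq_two finrank_twentyFour h2 i τ Φ h22
    ((isNondegenerate_iff_isSimple_twentyFour hB).2 hS)

end Summit.HodgeConjecture.Ring2WeilCoverage.CyclotomicWeilFourfoldsNonsimple

end
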